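import Summits.NavierStokesRegularity.NavierStokesRegularity.Theorems.PerpetualPumpAveragedTypeIBlowupIncubationTools

/-!
# Crux `PerpetualPump.AveragedTypeIBlowup` (stmt-NavierStokesRegularity-1835), line `Sketch`:
# stub `incubation` — a priori bounds of the bond before ignition

First half of the bootstrap behind the registered stub `stub_incubation` (phase I of the window
one-step theorem for the seeded Toda front pair `b' = -b - w² + wl² - ε̄ b w + e₀`,
`w' = w γ + ε̄ b² + e₁`, `γ ∈ [b - 2, b]`, memory error `|e₁| ≤ η m₁`).

`incubation_apriori`: on an initial segment `[0, σ]` of the pre-ignition horizon `[0, T]`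
(`w² ≤ θ₀² b`, `20 ≤ B e^{-T}`, `T ≤ 3`, `η e^{2T} ≤ 10⁻³`) on which the WEAK bootstrap bounds
hold (`B e^{-u} - 3/2 ≤ b ≤ B e^{-u} + Φ₁ + 1/2`, `m₁ ≤ μ₁ + ε̄ + 3|w| + 3 ε̄ (B+3)² u`), one has:
`b ∈ [37/2, B + 5/2]`; the memory error of the bond is dominated by the seed,
`|e₁| ≤ 3η|w| + ε̄ b²/50`; the bond is positive after time `0` (positivity barrier
`incubation_pos`); the two-sided rate bounds
`(b - 2.03) w + 0.98 ε̄ b² ≤ w' ≤ (b + 3η) w + 1.02 ε̄ b²`; the joint transfer bound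
`∫₀ᵘ (w² + ε̄ b w) ≤ (19/25) θ₀²` (from `(w²)' ≥ 2κ (w² + ε̄ b w)`, `κ = 0.98 (b(u) - 6.03)`, and
`w(u)² ≤ θ₀² b(u)`), and `∫₀ᵘ b w ≤ (9/8) w(u)` (from `w' ≥ (8/9) b w`).

## References

T. Tao, *Finite time blowup for an averaged three-dimensional Navier–Stokes equation*, J. Amer.
Math. Soc. 29 (2016), §5–6 (the circuit heuristics); the estimates themselves are folklore ODE
bookkeeping.
-/

noncomputable section

-- the summit namespace `…NavierStokesRegularity.NavierStokesRegularity…` is the tree convention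
set_option linter.dupNamespace false

open MeasureTheory Set Filter Topology

namespace Summit.NavierStokesRegularity.NavierStokesRegularity.Theorems.PerpetualPumpAveragedTypeIBlowup

/-- **Error budget of the bond (scalar bookkeeping).** With `η ≤ 1/100`, `η μ₁ ≤ ε̄`,
`η e^{2T} ≤ 10⁻³`, `0 ≤ u ≤ T ≤ 3` and a carrier value `β ≥ 37/2` with `B e^{-u} ≤ β + 3/2`
(so that `B + 3 ≤ e^{T} (β + 9/2)`), the memory-error budget of the weak bootstrap is a small
fraction of the seed: `η μ₁ + η ε̄ + 3 η ε̄ (B + 3)² u ≤ ε̄ β² / 50`. [folklore] -/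
theorem incubation_errBudget {B εb η μ₁ T u β : ℝ} (hεb : 0 < εb) (hη : 0 ≤ η)
    (hη' : η ≤ 1 / 100) (hημ₁ : η * μ₁ ≤ εb) (hηT : η * Real.exp (2 * T) ≤ 1 / 1000)
    (hT3 : T ≤ 3) (hu0 : 0 ≤ u) (huT : u ≤ T) (hB0 : 0 ≤ B) (hβ : 37 / 2 ≤ β)
    (hBu : B * Real.exp (-u) ≤ β + 3 / 2) :
    η * μ₁ + η * εb + 3 * η * εb * (B + 3) ^ 2 * u ≤ εb * β ^ 2 / 50 := by
  have hee : Real.exp u * Real.exp (-u) = 1 := by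
    rw [← Real.exp_add, add_neg_cancel, Real.exp_zero]
  have hEu := Real.exp_pos u
  have hB : B ≤ Real.exp u * (β + 3 / 2) := by
    have h1 : Real.exp u * (B * Real.exp (-u)) ≤ Real.exp u * (β + 3 / 2) :=
      mul_le_mul_of_nonneg_left hBu hEu.le
    calc B = Real.exp u * (B * Real.exp (-u)) := by
          rw [mul_comm B, ← mul_assoc, hee, one_mul]
      _ ≤ Real.exp u * (β + 3 / 2) := h1
  have h1u : 1 ≤ Real.exp u := Real.one_le_exp hu0
  have heT : Real.exp u ≤ Real.exp T := Real.exp_le_exp.2 huT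
  have hβ9 : 0 ≤ β + 9 / 2 := by linarith
  have h2 : Real.exp u * (β + 9 / 2) ≤ Real.exp T * (β + 9 / 2) :=
    mul_le_mul_of_nonneg_right heT hβ9
  have h3 : B + 3 ≤ Real.exp T * (β + 9 / 2) := by
    have : 3 ≤ Real.exp u * 3 := by linarith
    linarith [mul_add (Real.exp u) (β + 3 / 2) 3]
  have h4 : (B + 3) ^ 2 ≤ Real.exp T ^ 2 * (β + 9 / 2) ^ 2 := by
    rw [← mul_pow]
    exact pow_le_pow_left₀ (by linarith) h3 2
  have h5 : Real.exp T ^ 2 = Real.exp (2 * T) := by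
    rw [sq, ← Real.exp_add, two_mul]
  rw [h5] at h4
  have hsq : 0 ≤ (β + 9 / 2) ^ 2 := sq_nonneg _
  have h6 : η * (B + 3) ^ 2 ≤ (β + 9 / 2) ^ 2 / 1000 := by
    have h6a := mul_le_mul_of_nonneg_left h4 hη
    have h6b := mul_le_mul_of_nonneg_right hηT hsq
    linarith [h6a, h6b, mul_assoc η (Real.exp (2 * T)) ((β + 9 / 2) ^ 2)]
  have hεu : 0 ≤ 3 * εb * u := by positivity
  have h7 : 3 * η * εb * (B + 3) ^ 2 * u ≤ 3 * εb * u * ((β + 9 / 2) ^ 2 / 1000) := by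
    have := mul_le_mul_of_nonneg_left h6 hεu
    linarith [this, show 3 * η * εb * (B + 3) ^ 2 * u = 3 * εb * u * (η * (B + 3) ^ 2) by ring]
  have h8 : 3 * εb * u * ((β + 9 / 2) ^ 2 / 1000) ≤ 3 * εb * 3 * ((β + 9 / 2) ^ 2 / 1000) := by
    have hu3 : u ≤ 3 := huT.trans hT3
    have := mul_le_mul_of_nonneg_left hu3
      (by positivity : (0 : ℝ) ≤ 3 * εb * ((β + 9 / 2) ^ 2 / 1000))
    linarith [this]
  have h9 : η * εb ≤ 1 / 100 * εb := mul_le_mul_of_nonneg_right hη' hεb.le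
  have hββ : 37 / 2 * β ≤ β * β := mul_le_mul_of_nonneg_right hβ (by linarith)
  have hpoly : 1 + 1 / 100 + 9 * ((β + 9 / 2) ^ 2 / 1000) ≤ β ^ 2 / 50 := by
    nlinarith [hββ]
  have h10 := mul_le_mul_of_nonneg_left hpoly hεb.le
  linarith [h10]

/-- **Joint rate inequality (scalar bookkeeping).** If the bond rate satisfies
`D ≥ (β' - 2.03) w + 0.98 ε̄ β'²` at an earlier time where the carrier is `β' ≥ β - 4`, `β ≥ 37/2`
being the later carrier value, and `w ≥ 0`, then with `κ = 0.98 (β - 6.03)` one has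
`2κ (w² + ε̄ β' w) ≤ D w + w D` (the derivative of `w²` dominates `2κ (w² + ε̄ b w)`). [folklore] -/
theorem incubation_jointRate {εb β β' w D : ℝ} (hεb : 0 < εb) (hβ : 37 / 2 ≤ β)
    (hβ' : β - 4 ≤ β') (hw : 0 ≤ w)
    (hD : (β' - 203 / 100) * w + 49 / 50 * εb * β' ^ 2 ≤ D) :
    2 * (49 / 50 * (β - 603 / 100)) * (w ^ 2 + εb * β' * w) ≤ D * w + w * D := by
  set κ : ℝ := 49 / 50 * (β - 603 / 100) with hκ
  have hβ'0 : 0 ≤ β' := by linarith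
  have h1 : κ ≤ β' - 203 / 100 := by rw [hκ]; linarith
  have h2 : κ ≤ 49 / 50 * β' := by rw [hκ]; linarith
  have h3 : κ * w ≤ (β' - 203 / 100) * w := mul_le_mul_of_nonneg_right h1 hw
  have h4 : κ * (εb * β') ≤ 49 / 50 * β' * (εb * β') :=
    mul_le_mul_of_nonneg_right h2 (mul_nonneg hεb.le hβ'0)
  have hD' : κ * (w + εb * β') ≤ D := by
    have : 49 / 50 * β' * (εb * β') = 49 / 50 * εb * β' ^ 2 := by ring
    linarith [mul_add κ w (εb * β')]
  have h5 := mul_le_mul_of_nonneg_left hD' (by linarith : 0 ≤ 2 * w)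
  have : 2 * w * (κ * (w + εb * β')) = 2 * κ * (w ^ 2 + εb * β' * w) := by ring
  linarith

/-- **A priori bounds of the front bond before ignition, from the weak bootstrap bounds.**
See the module docstring: carrier window `[37/2, B + 5/2]`, seed-dominated memory error,
positivity of the bond, two-sided rate bounds, the joint transfer bound
`∫₀ᵘ (w² + ε̄ b w) ≤ (19/25) θ₀²` and `∫₀ᵘ b w ≤ (9/8) w(u)`. [folklore] -/
theorem incubation_apriori {b w γ e1 m1 : ℝ → ℝ} {B W₀ εb θ₀ η μ₁ Φ₁ T σ : ℝ}
    (hεb : 0 < εb) (hη : 0 ≤ η) (hη' : η ≤ 1 / 100) (hημ₁ : η * μ₁ ≤ εb)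
    (hηT : η * Real.exp (2 * T) ≤ 1 / 1000) (hΦ₁' : Φ₁ ≤ 2) (hT3 : T ≤ 3)
    (hW₀ : 0 ≤ W₀) (hBT : 20 ≤ B * Real.exp (-T))
    (hb : ContinuousOn b (Icc 0 T)) (hw : ContinuousOn w (Icc 0 T))
    (hγ : ContinuousOn γ (Icc 0 T))
    (hdw : ∀ s ∈ Ioo 0 T, HasDerivAt w (w s * γ s + εb * (b s) ^ 2 + e1 s) s)
    (hγb : ∀ s ∈ Icc 0 T, b s - 2 ≤ γ s ∧ γ s ≤ b s)
    (he1m : ∀ s ∈ Icc 0 T, |e1 s| ≤ η * m1 s) (hw0 : w 0 = W₀)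
    (hpre : ∀ s ∈ Icc 0 T, (w s) ^ 2 ≤ θ₀ ^ 2 * b s) (hσ : σ ∈ Icc 0 T)
    (hP : ∀ u ∈ Icc 0 σ, b u ≤ B * Real.exp (-u) + Φ₁ + 1 / 2 ∧
      B * Real.exp (-u) - 3 / 2 ≤ b u ∧
      m1 u ≤ μ₁ + εb + 3 * |w u| + 3 * εb * (B + 3) ^ 2 * u) :
    (∀ u ∈ Icc 0 σ, 37 / 2 ≤ b u ∧ b u ≤ B + 5 / 2) ∧
    (∀ u ∈ Icc 0 σ, |e1 u| ≤ 3 * η * |w u| + εb * (b u) ^ 2 / 50) ∧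
    (∀ u ∈ Icc 0 σ, 0 ≤ w u) ∧ (∀ u ∈ Ioc 0 σ, 0 < w u) ∧
    (∀ u ∈ Ioo 0 σ, (b u - 203 / 100) * w u + 49 / 50 * εb * (b u) ^ 2 ≤
        w u * γ u + εb * (b u) ^ 2 + e1 u ∧
      w u * γ u + εb * (b u) ^ 2 + e1 u ≤ (b u + 3 * η) * w u + 51 / 50 * εb * (b u) ^ 2) ∧
    (∀ u ∈ Icc 0 σ, ∫ s in (0 : ℝ)..u, ((w s) ^ 2 + εb * b s * w s) ≤ 19 / 25 * θ₀ ^ 2) ∧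
    (∀ u ∈ Icc 0 σ, ∫ s in (0 : ℝ)..u, (w s) ^ 2 ≤ 19 / 25 * θ₀ ^ 2) ∧
    (∀ u ∈ Icc 0 σ, ∫ s in (0 : ℝ)..u, b s * w s ≤ 9 / 8 * w u) := by
  have hσT : Icc 0 σ ⊆ Icc 0 T := Icc_subset_Icc_right hσ.2
  have hT0 : 0 ≤ T := hσ.1.trans hσ.2
  have hB0 : 0 < B := by
    by_contra h
    rw [not_lt] at h
    nlinarith [Real.exp_pos (-T)]
  have hB20 : 20 ≤ B :=
    hBT.trans (mul_le_of_le_one_right hB0.le (Real.exp_le_one_iff.2 (by linarith)))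
  -- (a) the carrier window
  have ha : ∀ u ∈ Icc 0 σ, 37 / 2 ≤ b u ∧ b u ≤ B + 5 / 2 := by
    intro u hu
    obtain ⟨hP1, hP2, -⟩ := hP u hu
    have he1' : Real.exp (-T) ≤ Real.exp (-u) := Real.exp_le_exp.2 (by linarith [hu.2, hσ.2])
    have he2 : Real.exp (-u) ≤ 1 := Real.exp_le_one_iff.2 (by linarith [hu.1])
    have h1 : B * Real.exp (-T) ≤ B * Real.exp (-u) := mul_le_mul_of_nonneg_left he1' hB0.le
    have h2 : B * Real.exp (-u) ≤ B := mul_le_of_le_one_right hB0.le he2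
    constructor <;> linarith
  -- the memory error of the bond is dominated by the seed
  have hE1 : ∀ u ∈ Icc 0 σ,
      η * μ₁ + η * εb + 3 * η * εb * (B + 3) ^ 2 * u ≤ εb * (b u) ^ 2 / 50 := by
    intro u hu
    obtain ⟨-, hP2, -⟩ := hP u hu
    exact incubation_errBudget hεb hη hη' hημ₁ hηT hT3 hu.1 (hu.2.trans hσ.2) hB0.le
      (ha u hu).1 (by linarith)
  -- (b) the bond error bound
  have hb' : ∀ u ∈ Icc 0 σ, |e1 u| ≤ 3 * η * |w u| + εb * (b u) ^ 2 / 50 := by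
    intro u hu
    obtain ⟨-, -, hP3⟩ := hP u hu
    have h1 := he1m u (hσT hu)
    have h2 : η * m1 u ≤ η * (μ₁ + εb + 3 * |w u| + 3 * εb * (B + 3) ^ 2 * u) :=
      mul_le_mul_of_nonneg_left hP3 hη
    have h3 := hE1 u hu
    nlinarith
  -- (c) positivity of the bond
  have hpos : ∀ u ∈ Ioc 0 σ, 0 < w u := by
    refine incubation_pos hσ.1 (hγ.mono hσT) (K := γ) (L := 3 * η)
      (c := fun t => εb * (b t) ^ 2 - (η * μ₁ + η * εb + 3 * η * εb * (B + 3) ^ 2 * t))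
      ?_ (hw.mono hσT) ?_ (by rw [hw0]; exact hW₀) ?_
    · exact (continuousOn_const.mul ((hb.mono hσT).pow 2)).sub
        (continuousOn_const.add (continuousOn_const.mul continuousOn_id))
    · intro t ht
      have h1 := hE1 t ht
      have h2 : 0 < εb * (b t) ^ 2 := by
        have := (ha t ht).1
        positivity
      show 0 < εb * (b t) ^ 2 - (η * μ₁ + η * εb + 3 * η * εb * (B + 3) ^ 2 * t)
      linarith
    · intro t ht
      have htσ : t ∈ Icc 0 σ := Ioo_subset_Icc_self ht
      refine ⟨_, hdw t ⟨ht.1, ht.2.trans_le hσ.2⟩, ?_⟩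
      obtain ⟨-, -, hP3⟩ := hP t htσ
      have h1 := he1m t (hσT htσ)
      have h2 : η * m1 t ≤ η * (μ₁ + εb + 3 * |w t| + 3 * εb * (B + 3) ^ 2 * t) :=
        mul_le_mul_of_nonneg_left hP3 hη
      have h3 := neg_abs_le (e1 t)
      show γ t * w t - 3 * η * |w t| +
          (εb * (b t) ^ 2 - (η * μ₁ + η * εb + 3 * η * εb * (B + 3) ^ 2 * t)) ≤
        w t * γ t + εb * (b t) ^ 2 + e1 t
      linarith
  have hnn : ∀ u ∈ Icc 0 σ, 0 ≤ w u := by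
    intro u hu
    rcases hu.1.lt_or_eq with h | h
    · exact (hpos u ⟨h, hu.2⟩).le
    · rw [← h, hw0]; exact hW₀
  -- (d) two-sided rate bounds
  have hrate : ∀ u ∈ Ioo 0 σ, (b u - 203 / 100) * w u + 49 / 50 * εb * (b u) ^ 2 ≤
        w u * γ u + εb * (b u) ^ 2 + e1 u ∧
      w u * γ u + εb * (b u) ^ 2 + e1 u ≤ (b u + 3 * η) * w u + 51 / 50 * εb * (b u) ^ 2 := by
    intro u hu
    have huσ : u ∈ Icc 0 σ := Ioo_subset_Icc_self hu
    obtain ⟨hγ1, hγ2⟩ := hγb u (hσT huσ)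
    have hwu := hnn u huσ
    have he := hb' u huσ
    rw [abs_of_nonneg hwu] at he
    have h1 := (abs_le.1 he).1
    have h2 := (abs_le.1 he).2
    have h3 : 0 ≤ w u * (γ u - (b u - 2)) := mul_nonneg hwu (by linarith)
    have h4 : 0 ≤ w u * (b u - γ u) := mul_nonneg hwu (by linarith)
    have h5 : 0 ≤ (1 / 100 - η) * w u := mul_nonneg (by linarith) hwu
    constructor <;> linarith
  -- the carrier earlier on the segment is at most `4` below its current value
  have hdrop : ∀ u ∈ Icc 0 σ, ∀ s ∈ Icc 0 u, b u - 4 ≤ b s := by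
    intro u hu s hs
    have hsσ : s ∈ Icc 0 σ := ⟨hs.1, hs.2.trans hu.2⟩
    obtain ⟨hP1, -, -⟩ := hP u hu
    obtain ⟨-, hP2, -⟩ := hP s hsσ
    have h1 : Real.exp (-u) ≤ Real.exp (-s) := Real.exp_le_exp.2 (by linarith [hs.2])
    have h2 := mul_le_mul_of_nonneg_left h1 hB0.le
    linarith
  -- (e) the joint transfer bound
  have hJ : ∀ u ∈ Icc 0 σ, ∫ s in (0 : ℝ)..u, ((w s) ^ 2 + εb * b s * w s) ≤ 19 / 25 * θ₀ ^ 2 := by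
    intro u hu
    have huT : Icc 0 u ⊆ Icc 0 T := Icc_subset_Icc_right (hu.2.trans hσ.2)
    obtain ⟨hbl, -⟩ := ha u hu
    set κ : ℝ := 49 / 50 * (b u - 603 / 100) with hκ
    have hκpos : 0 < κ := by rw [hκ]; linarith
    have hφc : ContinuousOn (fun s => 2 * κ * ((w s) ^ 2 + εb * b s * w s)) (Icc 0 u) :=
      continuousOn_const.mul (((hw.mono huT).pow 2).add
        ((continuousOn_const.mul (hb.mono huT)).mul (hw.mono huT)))
    have hmain := incubation_integral_le_sub hu.1 (g := fun s => w s * w s)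
      ((hw.mono huT).mul (hw.mono huT)) hφc ?_
    · rw [intervalIntegral.integral_const_mul] at hmain
      have hwu2 : w u * w u - w 0 * w 0 ≤ θ₀ ^ 2 * b u := by
        have := hpre u (hσT hu)
        nlinarith [mul_self_nonneg (w 0)]
      have hkey : θ₀ ^ 2 * b u ≤ 2 * κ * (19 / 25 * θ₀ ^ 2) := by
        have : 0 ≤ θ₀ ^ 2 * (2 * κ * (19 / 25) - b u) :=
          mul_nonneg (sq_nonneg θ₀) (by rw [hκ]; linarith)
        nlinarith
      exact le_of_mul_le_mul_left (by linarith) (by linarith : 0 < 2 * κ)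
    · intro s hs
      have hsσ : s ∈ Ioo 0 σ := ⟨hs.1, hs.2.trans_le hu.2⟩
      have hsT : s ∈ Ioo 0 T := ⟨hs.1, hs.2.trans_le (hu.2.trans hσ.2)⟩
      refine ⟨_, (hdw s hsT).mul (hdw s hsT), ?_⟩
      obtain ⟨hlo, -⟩ := hrate s hsσ
      have hws := hnn s (Ioo_subset_Icc_self hsσ)
      have hbs := hdrop u hu s ⟨hs.1.le, hs.2.le⟩
      exact incubation_jointRate hεb hbl hbs hws hlo
  -- (f) the transfer bound
  have hI2 : ∀ u ∈ Icc 0 σ, ∫ s in (0 : ℝ)..u, (w s) ^ 2 ≤ 19 / 25 * θ₀ ^ 2 := by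
    intro u hu
    have huT : Icc 0 u ⊆ Icc 0 T := Icc_subset_Icc_right (hu.2.trans hσ.2)
    refine le_trans (incubation_integral_mono hu.1 (f := fun s => (w s) ^ 2)
      (g := fun s => (w s) ^ 2 + εb * b s * w s) ((hw.mono huT).pow 2)
      (((hw.mono huT).pow 2).add ((continuousOn_const.mul (hb.mono huT)).mul (hw.mono huT)))
      fun s hs => ?_) (hJ u hu)
    show (w s) ^ 2 ≤ (w s) ^ 2 + εb * b s * w s
    have hsσ : s ∈ Icc 0 σ := ⟨hs.1, hs.2.trans hu.2⟩
    have h1 := hnn s hsσ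
    have h2 : 0 ≤ b s := by linarith [(ha s hsσ).1]
    have : 0 ≤ εb * b s * w s := by positivity
    linarith
  -- (g) slaving of `∫ b w` to `w`
  have hbw : ∀ u ∈ Icc 0 σ, ∫ s in (0 : ℝ)..u, b s * w s ≤ 9 / 8 * w u := by
    intro u hu
    have huT : Icc 0 u ⊆ Icc 0 T := Icc_subset_Icc_right (hu.2.trans hσ.2)
    have hmain := incubation_integral_le_sub hu.1 (g := fun s => 9 / 8 * w s)
      (φ := fun s => b s * w s)
      (continuousOn_const.mul (hw.mono huT)) ((hb.mono huT).mul (hw.mono huT)) ?_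
    · have h0 : 0 ≤ w 0 := by rw [hw0]; exact hW₀
      have : (9 : ℝ) / 8 * w u - 9 / 8 * w 0 ≤ 9 / 8 * w u := by linarith
      exact hmain.trans this
    · intro s hs
      have hsσ : s ∈ Ioo 0 σ := ⟨hs.1, hs.2.trans_le hu.2⟩
      have hsT : s ∈ Ioo 0 T := ⟨hs.1, hs.2.trans_le (hu.2.trans hσ.2)⟩
      refine ⟨_, (hdw s hsT).const_mul (9 / 8), ?_⟩
      obtain ⟨hlo, -⟩ := hrate s hsσ
      have hws := hnn s (Ioo_subset_Icc_self hsσ)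
      obtain ⟨hbl, -⟩ := ha s (Ioo_subset_Icc_self hsσ)
      have h1 : 0 ≤ (b s / 9 - 203 / 100) * w s := mul_nonneg (by linarith) hws
      have h2 : 0 ≤ εb * (b s) ^ 2 := by positivity
      show b s * w s ≤ 9 / 8 * (w s * γ s + εb * (b s) ^ 2 + e1 s)
      linarith
  exact ⟨ha, hb', hnn, hpos, hrate, hJ, hI2, hbw⟩

/-- **Registered sub-goal `stub_incubationApriori` of the stub `incubation`** (closed form of
`incubation_apriori`): the a priori bounds of the front bond before ignition on an initial
segment carrying the weak bootstrap bounds. [folklore] -/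
theorem stub_incubationApriori :
    ∀ (b w γ e1 m1 : ℝ → ℝ) (B W₀ εb θ₀ η μ₁ Φ₁ T σ : ℝ),
      0 < εb → 0 ≤ η → η ≤ 1 / 100 → η * μ₁ ≤ εb → η * Real.exp (2 * T) ≤ 1 / 1000 → Φ₁ ≤ 2 →
      T ≤ 3 → 0 ≤ W₀ → 20 ≤ B * Real.exp (-T) →
      ContinuousOn b (Icc 0 T) → ContinuousOn w (Icc 0 T) → ContinuousOn γ (Icc 0 T) →
      (∀ s ∈ Ioo 0 T, HasDerivAt w (w s * γ s + εb * (b s) ^ 2 + e1 s) s) →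
      (∀ s ∈ Icc 0 T, b s - 2 ≤ γ s ∧ γ s ≤ b s) → (∀ s ∈ Icc 0 T, |e1 s| ≤ η * m1 s) →
      w 0 = W₀ → (∀ s ∈ Icc 0 T, (w s) ^ 2 ≤ θ₀ ^ 2 * b s) → σ ∈ Icc 0 T →
      (∀ u ∈ Icc 0 σ, b u ≤ B * Real.exp (-u) + Φ₁ + 1 / 2 ∧ B * Real.exp (-u) - 3 / 2 ≤ b u ∧
        m1 u ≤ μ₁ + εb + 3 * |w u| + 3 * εb * (B + 3) ^ 2 * u) →
      (∀ u ∈ Icc 0 σ, 37 / 2 ≤ b u ∧ b u ≤ B + 5 / 2) ∧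
      (∀ u ∈ Icc 0 σ, |e1 u| ≤ 3 * η * |w u| + εb * (b u) ^ 2 / 50) ∧
      (∀ u ∈ Icc 0 σ, 0 ≤ w u) ∧ (∀ u ∈ Ioc 0 σ, 0 < w u) ∧
      (∀ u ∈ Ioo 0 σ, (b u - 203 / 100) * w u + 49 / 50 * εb * (b u) ^ 2 ≤
          w u * γ u + εb * (b u) ^ 2 + e1 u ∧
        w u * γ u + εb * (b u) ^ 2 + e1 u ≤ (b u + 3 * η) * w u + 51 / 50 * εb * (b u) ^ 2) ∧
      (∀ u ∈ Icc 0 σ, ∫ s in (0 : ℝ)..u, ((w s) ^ 2 + εb * b s * w s) ≤ 19 / 25 * θ₀ ^ 2) ∧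
      (∀ u ∈ Icc 0 σ, ∫ s in (0 : ℝ)..u, (w s) ^ 2 ≤ 19 / 25 * θ₀ ^ 2) ∧
      (∀ u ∈ Icc 0 σ, ∫ s in (0 : ℝ)..u, b s * w s ≤ 9 / 8 * w u) :=
  fun _ _ _ _ _ _ _ _ _ _ _ _ _ _ hεb hη hη' hημ₁ hηT hΦ₁' hT3 hW₀ hBT hb hw hγ hdw hγb he1m hw0
      hpre hσ hP =>
    incubation_apriori hεb hη hη' hημ₁ hηT hΦ₁' hT3 hW₀ hBT hb hw hγ hdw hγb he1m hw0 hpre hσ hP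

end Summit.NavierStokesRegularity.NavierStokesRegularity.Theorems.PerpetualPumpAveragedTypeIBlowup

end
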